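import Literature.NumberTheory.Rogawski1990.CMLocalCharacterIdentities
import Literature.NumberTheory.Rogawski1990.GlobalAPacketMembership
import Literature.NumberTheory.Rogawski1990.U3PrincipalSeriesReducibility
import Literature.NumberTheory.Rogawski1990.XiLocalCharacter
import HarnessLib

/-!
# The CM character-identity clauses of the JOINT transfer letter [Rogawski1990, Prop. 13.1.4; Lemma 4.13.1 (b)] — `Q_CM` of RULING (V29)

Topic `NumberTheory/Rogawski1990`; namespace `Literature.NumberTheory.Rogawski1990`.  TWO DEFINITIONS WITH BODY (`Prop`-valued predicates on GIVEN
global data) + their `Iff.rfl` unfoldings and read-backs; no named fact, no instance, no notation, no attribute, no `sorry`.  This file ASSERTS NOTHING: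
the letter that asserts these clauses is ONE joint existential — ED. 5 of ★ `TransferFactsStabilisation.lean`'s parametric
`GlobalTransferWithStabilisationPackageAnd … (Q : (Δ_v)_v → (m_{H,v})_v → (m_{G,v})_v → Prop)` instantiated at `Q := CMCharIdentityPackage …` below
(RULING (V29) (J1): «the CM identities ride the SAME existential as `Δ`»; the instantiated letter `GlobalTransferWithCMCharIdentities` is ED. 2 of this
file, one line, once ED. 5 is ★).

WHY A JOINT EXISTENTIAL (the Δ-twist, P3b caveat 2026-08-31 sustained by (V29) and REF1 R-16): Rogawski's transfer factor `Δ_{G∕H}` is defined THROUGH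
the auxiliary Hecke character `μ` [§4.9 pp. 54–55], but the tree's `LocalTransferFactor` is `μ`-free data `Δ_v(γ_H, γ)`; every clause of ★
`GlobalTransferWithStabilisationPackage` (local transfers exist, unit fundamental lemma off `S_bad`, product formula, κ-package) survives the twist
`Δ ↦ θ_H · Δ` by an automorphic character `θ` of `H(𝔸)` with `θ_∞ = 1`, whereas [13.1.4] at `θ_H · Δ` holds for the packets `Π(ξ θ_H⁻¹)`, not for the
`μ`-labelled `{πⁿ(ξ_v), πˢ(ξ_v)}`.  So the identities cannot be a free-standing letter about an existentially produced `Δ`; conjoined with the package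
they FORCE the witness to be `μ`-compatible at every finite place, and every `πˢ` read off downstream (★ `CMNonsplitCharIdentityAt.πs`) is print's `πˢ(ξ_v)`.

* `CMCharIdentityClauses L H hH hHd Δ mH mG νH νG ξ μω hμu ξloc` — for the global data `(Δ_v, m_{H,v}, m_{G,v})_v`, Haar families `ν_H, ν_G`, a global
  character `ξ` of `H` (★ `OneDimAutRepH`), the auxiliary unitary Hecke character `μ = μω` and local characters `ξloc v` of `H_v`:
  NON-SPLIT clause [Prop. 13.1.4 + 13.1.3 (d) p. 199; §12.2 (2) p. 174] at EVERY non-split finite `v` (REF1 (S1): no `S_bad` exception), every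
  identification of congruence type `e = cmDatumLocalCongr L v T ha h : U(Φ₃)(L⁺_v) ≃ U(H)(L⁺_v)` (★ `LocalUnitaryGroupCongr`), every Haar measure `μZ`
  on `U(Φ₃)(L⁺_v) ⧸ Z` (binder shape of ★ `KeysCaseTwo`) and every Keys-labelled pair `(π², πⁿ)` of `JH(i_G(χ_ξ))` (★ `KeysCaseTwoLabels` at the local
  components ★ `torusLocalComponent` of `ξ.η, ξ.ψ` and ★ `semilocalComponent` of `μω`) with `πⁿ` the NON-square-integrable member ((R1) of RULING (V26);
  ★ `IrrClass.IsSquareIntegrable`): `CMNonsplitCharIdentityAt` (★ ED. 2) at `(Δ_v, m_{H,v}, m_{G,v}, ν_{G,v}, ν_{H,v}, ξloc v)` and `πⁿ ∘ e⁻¹`;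
  SPLIT clause [13.1.4 at split `v` = Lemma 4.13.1 (b); §13.3 p. 201] at EVERY split `v`: `CMSplitCharIdentityAt` at the fixed witness `w = splitWitness v hs`
  with labels `ν₀ = η_w ψ_w μ_w`, `χ′ = ψ_w` (★ `OneDimAutRepH.splitν₀` ∕ `locψ` — the member of ★ `IsXiLocalFamily`'s split clause).
* `CMCharIdentityPackage L H hH hHd νH νG μω hμu : (Δ_v)_v → (m_{H,v})_v → (m_{G,v})_v → Prop` — `Q_CM` of (V29): `fun Δ mH mG ↦ ∀ ξ : OneDimAutRepH L,
  CMCharIdentityClauses … ξ μω hμu (fun v ↦ ξ.xiLocalChar v)` with the local characters BY NAME (★ `OneDimAutRepH.xiLocalChar`, Q2).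
* `cmCharIdentityClauses_iff`, `cmCharIdentityPackage_iff` (`Iff.rfl`); read-backs `CMCharIdentityClauses.nonsplit`, `.split`, `CMCharIdentityPackage.clauses`,
  `.nonsplit`, `.split` — the shapes the consumer (P3 `xiFamilyOfRecord` ED. 2, (J3): slot `some (hCM.nonsplit ξ v … π2 πn hK hn).πs`) destructures.

Registry pub/hodgecm-mathlib F0∕P3b, row Z5-L part B; statements = F0P3b-plan (g6) draft `F0/P3b/z5l/GlobalTransferWithCMCharIdentities.partB-clauses.draft…`
(beabe1b2) with TWO deltas: the Haar measure `μZ` on `G ⧸ Z` is quantified INSIDE the non-split clause in ★ `KeysCaseTwo`'s binder shape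
(`∀ [MeasurableSpace] [BorelSpace] (μZ) [μZ.IsHaarMeasure]`, so the package predicate has the three arguments `(Δ, m_H, m_G)` of (V29) and no measure
parameter a non-Haar instance could abuse), and `ξloc` is instantiated by name in the package.  HC_CM is proved only modulo the printed citations until
rung 0 closes; this file proves none.

## References
* [Rogawski1990] J. D. Rogawski, *Automorphic Representations of Unitary Groups in Three Variables*, Ann. of Math. Studies 123 (1990): §4.9 pp. 54–55,
  §4.13 Lemma 4.13.1 (b), §12.2 p. 174, §13.1 Prop. 13.1.3 (d) and Prop. 13.1.4 p. 199, §13.3 pp. 201–202.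
-/

set_option autoImplicit false

noncomputable section

open NumberField IsDedekindDomain MeasureTheory
open scoped Matrix ComplexOrder

namespace Literature.NumberTheory.Rogawski1990

open Literature.NumberTheory.Automorphic Literature.NumberTheory.Automorphic.UnitaryGroup
open Literature.NumberTheory.Automorphic.UnitaryGroup.CotangentForms Literature.NumberTheory.GaloisRepresentations
open Literature.NumberTheory.Automorphic.Arthur2013.Leaves.TECR

section Clauses

variable (L : Type) [Field L] [NumberField L] [IsCMField L] (H : Matrix (Fin 3) (Fin 3) L)
  (hH : (H.map (cmConjRingHom L))ᵀ = H) (hHd : IsUnit H.det)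

/-- **The CM character-identity clauses of the joint letter**: for the global data `(Δ_v, m_{H,v}, m_{G,v}, ν_{H,v}, ν_{G,v})_v`, the character `ξ`
of `H`, the auxiliary `μ = μω` and the local characters `ξ_v = ξloc v` — at every NON-SPLIT finite `v` the identity [13.1.4] for the A-packet
`{πⁿ(ξ_v) ∘ e⁻¹, πˢ}` (`πⁿ` = the non-square-integrable Keys constituent for any Haar measure on `G ⧸ Z`, `πˢ` supercuspidal, existential), and at
every SPLIT `v` the identity for `{i_G(ξ_v ⊗ μ_w ∘ det₀)}`.
[cite: Rogawski1990, §13.1 Prop. 13.1.3 (d), Prop. 13.1.4 p. 199; §12.2 p. 174; §4.13 Lemma 4.13.1 (b); §13.3 p. 201] -/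
def CMCharIdentityClauses
    [∀ v : HeightOneSpectrum (𝓞 ↥(maximalRealSubfield L)), MeasurableSpace ((cmDatum L 3 H).Local v)]
    [∀ v : HeightOneSpectrum (𝓞 ↥(maximalRealSubfield L)),
      MeasurableSpace ((cmDatum L 2 (Matrix.of fun i j : Fin 2 => if i.val + j.val + 1 = 2 then (1 : L) else 0)).Local v ×
        (cmDatum L 1 (Matrix.of fun i j : Fin 1 => if i.val + j.val + 1 = 1 then (1 : L) else 0)).Local v)]
    [∀ (v : HeightOneSpectrum (𝓞 ↥(maximalRealSubfield L)))
        (a : ((cmDatum L 2 (Matrix.of fun i j : Fin 2 => if i.val + j.val + 1 = 2 then (1 : L) else 0)).Local v ×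
          (cmDatum L 1 (Matrix.of fun i j : Fin 1 => if i.val + j.val + 1 = 1 then (1 : L) else 0)).Local v)),
      MeasurableSpace (((cmDatum L 2 (Matrix.of fun i j : Fin 2 => if i.val + j.val + 1 = 2 then (1 : L) else 0)).Local v ×
          (cmDatum L 1 (Matrix.of fun i j : Fin 1 => if i.val + j.val + 1 = 1 then (1 : L) else 0)).Local v) ⧸
        Subgroup.centralizer ({a} : Set ((cmDatum L 2 (Matrix.of fun i j : Fin 2 => if i.val + j.val + 1 = 2 then (1 : L) else 0)).Local v ×
          (cmDatum L 1 (Matrix.of fun i j : Fin 1 => if i.val + j.val + 1 = 1 then (1 : L) else 0)).Local v)))]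
    [∀ (v : HeightOneSpectrum (𝓞 ↥(maximalRealSubfield L))) (γ : (cmDatum L 3 H).Local v),
      MeasurableSpace ((cmDatum L 3 H).Local v ⧸ Subgroup.centralizer ({γ} : Set ((cmDatum L 3 H).Local v)))]
    (Δ : ∀ v : HeightOneSpectrum (𝓞 ↥(maximalRealSubfield L)), LocalTransferFactor L H v)
    (mH : ∀ v : HeightOneSpectrum (𝓞 ↥(maximalRealSubfield L)),
      OrbitalMeasureFamily ((cmDatum L 2 (Matrix.of fun i j : Fin 2 => if i.val + j.val + 1 = 2 then (1 : L) else 0)).Local v ×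
        (cmDatum L 1 (Matrix.of fun i j : Fin 1 => if i.val + j.val + 1 = 1 then (1 : L) else 0)).Local v))
    (mG : ∀ v : HeightOneSpectrum (𝓞 ↥(maximalRealSubfield L)), OrbitalMeasureFamily ((cmDatum L 3 H).Local v))
    (νH : ∀ v : HeightOneSpectrum (𝓞 ↥(maximalRealSubfield L)),
      Measure ((cmDatum L 2 (Matrix.of fun i j : Fin 2 => if i.val + j.val + 1 = 2 then (1 : L) else 0)).Local v ×
        (cmDatum L 1 (Matrix.of fun i j : Fin 1 => if i.val + j.val + 1 = 1 then (1 : L) else 0)).Local v))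
    (νG : ∀ v : HeightOneSpectrum (𝓞 ↥(maximalRealSubfield L)), Measure ((cmDatum L 3 H).Local v))
    (ξ : OneDimAutRepH L) (μω : HeckeCharacter L) (hμu : μω.IsUnitary)
    (ξloc : ∀ v : HeightOneSpectrum (𝓞 ↥(maximalRealSubfield L)),
      (cmDatum L 2 (Matrix.of fun i j : Fin 2 => if i.val + j.val + 1 = 2 then (1 : L) else 0)).Local v ×
        (cmDatum L 1 (Matrix.of fun i j : Fin 1 => if i.val + j.val + 1 = 1 then (1 : L) else 0)).Local v →* ℂˣ) : Prop :=
  (∀ (v : HeightOneSpectrum (𝓞 ↥(maximalRealSubfield L))),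
      (∀ w : PlacesOver L v, IsCMField.complexConj L • w.1 = w.1) →
      ∀ (T : GL (Fin 3) (LocalRing L v)) (a : LocalRing L v) (ha : IsUnit a)
        (h : formCongr (conjLocal L (IsCMField.complexConj L) v) T (H.map (algebraMap L (LocalRing L v))) =
          a • (Matrix.of fun i j : Fin 3 => if i.val + j.val + 1 = 3 then (1 : L) else 0).map (algebraMap L (LocalRing L v))),
      ∀ [MeasurableSpace (Gqs L v ⧸ Subgroup.center (Gqs L v))] [BorelSpace (Gqs L v ⧸ Subgroup.center (Gqs L v))]
        (μZ : Measure (Gqs L v ⧸ Subgroup.center (Gqs L v))) [μZ.IsHaarMeasure],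
      ∀ (π2 πn : IrrClass (Gqs L v)),
        KeysCaseTwoLabels L v (μω.semilocalComponent L v) (torusLocalComponent L (IsCMField.complexConj L) v ξ.η)
          (torusLocalComponent L (IsCMField.complexConj L) v ξ.ψ) π2 πn →
        ¬ πn.IsSquareIntegrable μZ →
        CMNonsplitCharIdentityAt L v H (Δ v) (mH v) (mG v) (νG v) (νH v) (ξloc v)
          (IrrClass.comap (cmDatumLocalCongr L v T ha h).symm πn)) ∧
  (∀ (v : HeightOneSpectrum (𝓞 ↥(maximalRealSubfield L))) (hs : ∃ w : PlacesOver L v, IsCMField.complexConj L • w.1 ≠ w.1),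
      CMSplitCharIdentityAt L v H hH hHd (splitWitness v hs) (splitWitness_spec v hs) (ξ.splitν₀ μω (splitWitness v hs).1)
        (ξ.locψ (splitWitness v hs).1) (ξ.norm_splitν₀_apply hμu (splitWitness v hs).1)
        (ξ.continuous_splitν₀ μω (splitWitness v hs).1) (ξ.norm_locψ_apply (splitWitness v hs).1)
        (ξ.continuous_locψ (splitWitness v hs).1) (Δ v) (mH v) (mG v) (νG v) (νH v) (ξloc v))

/-- **`Q_CM` of RULING (V29) — the CM character-identity package** read by the parametric joint letter: for the global data `(Δ_v, m_{H,v}, m_{G,v})_v`,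
the clauses `CMCharIdentityClauses` for EVERY global character `ξ` of `H`, at the local characters `ξ_v = ξ.xiLocalChar v` BY NAME.
[cite: Rogawski1990, §13.1 Prop. 13.1.4 p. 199; §4.13 Lemma 4.13.1 (b); §13.3 p. 202] -/
def CMCharIdentityPackage
    [∀ v : HeightOneSpectrum (𝓞 ↥(maximalRealSubfield L)), MeasurableSpace ((cmDatum L 3 H).Local v)]
    [∀ v : HeightOneSpectrum (𝓞 ↥(maximalRealSubfield L)),
      MeasurableSpace ((cmDatum L 2 (Matrix.of fun i j : Fin 2 => if i.val + j.val + 1 = 2 then (1 : L) else 0)).Local v ×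
        (cmDatum L 1 (Matrix.of fun i j : Fin 1 => if i.val + j.val + 1 = 1 then (1 : L) else 0)).Local v)]
    [∀ (v : HeightOneSpectrum (𝓞 ↥(maximalRealSubfield L)))
        (a : ((cmDatum L 2 (Matrix.of fun i j : Fin 2 => if i.val + j.val + 1 = 2 then (1 : L) else 0)).Local v ×
          (cmDatum L 1 (Matrix.of fun i j : Fin 1 => if i.val + j.val + 1 = 1 then (1 : L) else 0)).Local v)),
      MeasurableSpace (((cmDatum L 2 (Matrix.of fun i j : Fin 2 => if i.val + j.val + 1 = 2 then (1 : L) else 0)).Local v ×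
          (cmDatum L 1 (Matrix.of fun i j : Fin 1 => if i.val + j.val + 1 = 1 then (1 : L) else 0)).Local v) ⧸
        Subgroup.centralizer ({a} : Set ((cmDatum L 2 (Matrix.of fun i j : Fin 2 => if i.val + j.val + 1 = 2 then (1 : L) else 0)).Local v ×
          (cmDatum L 1 (Matrix.of fun i j : Fin 1 => if i.val + j.val + 1 = 1 then (1 : L) else 0)).Local v)))]
    [∀ (v : HeightOneSpectrum (𝓞 ↥(maximalRealSubfield L))) (γ : (cmDatum L 3 H).Local v),
      MeasurableSpace ((cmDatum L 3 H).Local v ⧸ Subgroup.centralizer ({γ} : Set ((cmDatum L 3 H).Local v)))]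
    (νH : ∀ v : HeightOneSpectrum (𝓞 ↥(maximalRealSubfield L)),
      Measure ((cmDatum L 2 (Matrix.of fun i j : Fin 2 => if i.val + j.val + 1 = 2 then (1 : L) else 0)).Local v ×
        (cmDatum L 1 (Matrix.of fun i j : Fin 1 => if i.val + j.val + 1 = 1 then (1 : L) else 0)).Local v))
    (νG : ∀ v : HeightOneSpectrum (𝓞 ↥(maximalRealSubfield L)), Measure ((cmDatum L 3 H).Local v))
    (μω : HeckeCharacter L) (hμu : μω.IsUnitary) :
    (∀ v : HeightOneSpectrum (𝓞 ↥(maximalRealSubfield L)), LocalTransferFactor L H v) →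
    (∀ v : HeightOneSpectrum (𝓞 ↥(maximalRealSubfield L)),
      OrbitalMeasureFamily ((cmDatum L 2 (Matrix.of fun i j : Fin 2 => if i.val + j.val + 1 = 2 then (1 : L) else 0)).Local v ×
        (cmDatum L 1 (Matrix.of fun i j : Fin 1 => if i.val + j.val + 1 = 1 then (1 : L) else 0)).Local v)) →
    (∀ v : HeightOneSpectrum (𝓞 ↥(maximalRealSubfield L)), OrbitalMeasureFamily ((cmDatum L 3 H).Local v)) → Prop :=
  fun Δ mH mG => ∀ ξ : OneDimAutRepH L, CMCharIdentityClauses L H hH hHd Δ mH mG νH νG ξ μω hμu (fun v => ξ.xiLocalChar v)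

variable {L H hH hHd}
variable
  [∀ v : HeightOneSpectrum (𝓞 ↥(maximalRealSubfield L)), MeasurableSpace ((cmDatum L 3 H).Local v)]
  [∀ v : HeightOneSpectrum (𝓞 ↥(maximalRealSubfield L)),
    MeasurableSpace ((cmDatum L 2 (Matrix.of fun i j : Fin 2 => if i.val + j.val + 1 = 2 then (1 : L) else 0)).Local v ×
      (cmDatum L 1 (Matrix.of fun i j : Fin 1 => if i.val + j.val + 1 = 1 then (1 : L) else 0)).Local v)]
  [∀ (v : HeightOneSpectrum (𝓞 ↥(maximalRealSubfield L)))
      (a : ((cmDatum L 2 (Matrix.of fun i j : Fin 2 => if i.val + j.val + 1 = 2 then (1 : L) else 0)).Local v ×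
        (cmDatum L 1 (Matrix.of fun i j : Fin 1 => if i.val + j.val + 1 = 1 then (1 : L) else 0)).Local v)),
    MeasurableSpace (((cmDatum L 2 (Matrix.of fun i j : Fin 2 => if i.val + j.val + 1 = 2 then (1 : L) else 0)).Local v ×
        (cmDatum L 1 (Matrix.of fun i j : Fin 1 => if i.val + j.val + 1 = 1 then (1 : L) else 0)).Local v) ⧸
      Subgroup.centralizer ({a} : Set ((cmDatum L 2 (Matrix.of fun i j : Fin 2 => if i.val + j.val + 1 = 2 then (1 : L) else 0)).Local v ×
        (cmDatum L 1 (Matrix.of fun i j : Fin 1 => if i.val + j.val + 1 = 1 then (1 : L) else 0)).Local v)))]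
  [∀ (v : HeightOneSpectrum (𝓞 ↥(maximalRealSubfield L))) (γ : (cmDatum L 3 H).Local v),
    MeasurableSpace ((cmDatum L 3 H).Local v ⧸ Subgroup.centralizer ({γ} : Set ((cmDatum L 3 H).Local v)))]
  {Δ : ∀ v : HeightOneSpectrum (𝓞 ↥(maximalRealSubfield L)), LocalTransferFactor L H v}
  {mH : ∀ v : HeightOneSpectrum (𝓞 ↥(maximalRealSubfield L)),
    OrbitalMeasureFamily ((cmDatum L 2 (Matrix.of fun i j : Fin 2 => if i.val + j.val + 1 = 2 then (1 : L) else 0)).Local v ×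
      (cmDatum L 1 (Matrix.of fun i j : Fin 1 => if i.val + j.val + 1 = 1 then (1 : L) else 0)).Local v)}
  {mG : ∀ v : HeightOneSpectrum (𝓞 ↥(maximalRealSubfield L)), OrbitalMeasureFamily ((cmDatum L 3 H).Local v)}
  {νH : ∀ v : HeightOneSpectrum (𝓞 ↥(maximalRealSubfield L)),
    Measure ((cmDatum L 2 (Matrix.of fun i j : Fin 2 => if i.val + j.val + 1 = 2 then (1 : L) else 0)).Local v ×
      (cmDatum L 1 (Matrix.of fun i j : Fin 1 => if i.val + j.val + 1 = 1 then (1 : L) else 0)).Local v)}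
  {νG : ∀ v : HeightOneSpectrum (𝓞 ↥(maximalRealSubfield L)), Measure ((cmDatum L 3 H).Local v)}
  {ξ : OneDimAutRepH L} {μω : HeckeCharacter L} {hμu : μω.IsUnitary}
  {ξloc : ∀ v : HeightOneSpectrum (𝓞 ↥(maximalRealSubfield L)),
    (cmDatum L 2 (Matrix.of fun i j : Fin 2 => if i.val + j.val + 1 = 2 then (1 : L) else 0)).Local v ×
      (cmDatum L 1 (Matrix.of fun i j : Fin 1 => if i.val + j.val + 1 = 1 then (1 : L) else 0)).Local v →* ℂˣ}

/-- Unfolding of `CMCharIdentityClauses`, token for token. [cite: Rogawski1990, §13.1 Prop. 13.1.4 p. 199; §4.13 Lemma 4.13.1 (b)] -/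
theorem cmCharIdentityClauses_iff :
    CMCharIdentityClauses L H hH hHd Δ mH mG νH νG ξ μω hμu ξloc ↔
      (∀ (v : HeightOneSpectrum (𝓞 ↥(maximalRealSubfield L))),
          (∀ w : PlacesOver L v, IsCMField.complexConj L • w.1 = w.1) →
          ∀ (T : GL (Fin 3) (LocalRing L v)) (a : LocalRing L v) (ha : IsUnit a)
            (h : formCongr (conjLocal L (IsCMField.complexConj L) v) T (H.map (algebraMap L (LocalRing L v))) =
              a • (Matrix.of fun i j : Fin 3 => if i.val + j.val + 1 = 3 then (1 : L) else 0).map (algebraMap L (LocalRing L v))),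
          ∀ [MeasurableSpace (Gqs L v ⧸ Subgroup.center (Gqs L v))] [BorelSpace (Gqs L v ⧸ Subgroup.center (Gqs L v))]
            (μZ : Measure (Gqs L v ⧸ Subgroup.center (Gqs L v))) [μZ.IsHaarMeasure],
          ∀ (π2 πn : IrrClass (Gqs L v)),
            KeysCaseTwoLabels L v (μω.semilocalComponent L v) (torusLocalComponent L (IsCMField.complexConj L) v ξ.η)
              (torusLocalComponent L (IsCMField.complexConj L) v ξ.ψ) π2 πn →
            ¬ πn.IsSquareIntegrable μZ →
            CMNonsplitCharIdentityAt L v H (Δ v) (mH v) (mG v) (νG v) (νH v) (ξloc v)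
              (IrrClass.comap (cmDatumLocalCongr L v T ha h).symm πn)) ∧
      (∀ (v : HeightOneSpectrum (𝓞 ↥(maximalRealSubfield L))) (hs : ∃ w : PlacesOver L v, IsCMField.complexConj L • w.1 ≠ w.1),
          CMSplitCharIdentityAt L v H hH hHd (splitWitness v hs) (splitWitness_spec v hs) (ξ.splitν₀ μω (splitWitness v hs).1)
            (ξ.locψ (splitWitness v hs).1) (ξ.norm_splitν₀_apply hμu (splitWitness v hs).1)
            (ξ.continuous_splitν₀ μω (splitWitness v hs).1) (ξ.norm_locψ_apply (splitWitness v hs).1)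
            (ξ.continuous_locψ (splitWitness v hs).1) (Δ v) (mH v) (mG v) (νG v) (νH v) (ξloc v)) :=
  Iff.rfl

/-- **Read-back at a NON-SPLIT place** (the shape the consumer's slot `some (…).πs` destructures): the identity [13.1.4] for `{πⁿ ∘ e⁻¹, πˢ}`.
[cite: Rogawski1990, §13.1 Prop. 13.1.3 (d), Prop. 13.1.4 p. 199; §12.2 p. 174] -/
theorem CMCharIdentityClauses.nonsplit (hCM : CMCharIdentityClauses L H hH hHd Δ mH mG νH νG ξ μω hμu ξloc)
    (v : HeightOneSpectrum (𝓞 ↥(maximalRealSubfield L))) (hns : ∀ w : PlacesOver L v, IsCMField.complexConj L • w.1 = w.1)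
    (T : GL (Fin 3) (LocalRing L v)) (a : LocalRing L v) (ha : IsUnit a)
    (h : formCongr (conjLocal L (IsCMField.complexConj L) v) T (H.map (algebraMap L (LocalRing L v))) =
      a • (Matrix.of fun i j : Fin 3 => if i.val + j.val + 1 = 3 then (1 : L) else 0).map (algebraMap L (LocalRing L v)))
    [MeasurableSpace (Gqs L v ⧸ Subgroup.center (Gqs L v))] [BorelSpace (Gqs L v ⧸ Subgroup.center (Gqs L v))]
    (μZ : Measure (Gqs L v ⧸ Subgroup.center (Gqs L v))) [μZ.IsHaarMeasure] (π2 πn : IrrClass (Gqs L v))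
    (hK : KeysCaseTwoLabels L v (μω.semilocalComponent L v) (torusLocalComponent L (IsCMField.complexConj L) v ξ.η)
      (torusLocalComponent L (IsCMField.complexConj L) v ξ.ψ) π2 πn)
    (hn : ¬ πn.IsSquareIntegrable μZ) :
    CMNonsplitCharIdentityAt L v H (Δ v) (mH v) (mG v) (νG v) (νH v) (ξloc v) (IrrClass.comap (cmDatumLocalCongr L v T ha h).symm πn) :=
  hCM.1 v hns T a ha h μZ π2 πn hK hn

/-- **Read-back at a SPLIT place**: the identity for the singleton packet `{i_G(ξ_v ⊗ μ_w ∘ det₀)}` at the fixed witness `w = splitWitness v hs`.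
[cite: Rogawski1990, §4.13 Lemma 4.13.1 (b); §13.1 Prop. 13.1.4 p. 199; §13.3 p. 201] -/
theorem CMCharIdentityClauses.split (hCM : CMCharIdentityClauses L H hH hHd Δ mH mG νH νG ξ μω hμu ξloc)
    (v : HeightOneSpectrum (𝓞 ↥(maximalRealSubfield L))) (hs : ∃ w : PlacesOver L v, IsCMField.complexConj L • w.1 ≠ w.1) :
    CMSplitCharIdentityAt L v H hH hHd (splitWitness v hs) (splitWitness_spec v hs) (ξ.splitν₀ μω (splitWitness v hs).1)
      (ξ.locψ (splitWitness v hs).1) (ξ.norm_splitν₀_apply hμu (splitWitness v hs).1)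
      (ξ.continuous_splitν₀ μω (splitWitness v hs).1) (ξ.norm_locψ_apply (splitWitness v hs).1)
      (ξ.continuous_locψ (splitWitness v hs).1) (Δ v) (mH v) (mG v) (νG v) (νH v) (ξloc v) :=
  hCM.2 v hs

/-- Unfolding of `CMCharIdentityPackage` (`Q_CM Δ m_H m_G ↔ ∀ ξ, CMCharIdentityClauses … ξ … (ξ.xiLocalChar ·)`).
[cite: Rogawski1990, §13.1 Prop. 13.1.4 p. 199; §13.3 p. 202] -/
theorem cmCharIdentityPackage_iff :
    CMCharIdentityPackage L H hH hHd νH νG μω hμu Δ mH mG ↔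
      ∀ ξ : OneDimAutRepH L, CMCharIdentityClauses L H hH hHd Δ mH mG νH νG ξ μω hμu (fun v => ξ.xiLocalChar v) :=
  Iff.rfl

/-- **Read-back of the package at a character `ξ`.** [cite: Rogawski1990, §13.1 Prop. 13.1.4 p. 199; §13.3 p. 202] -/
theorem CMCharIdentityPackage.clauses (hQ : CMCharIdentityPackage L H hH hHd νH νG μω hμu Δ mH mG) (ξ : OneDimAutRepH L) :
    CMCharIdentityClauses L H hH hHd Δ mH mG νH νG ξ μω hμu (fun v => ξ.xiLocalChar v) :=
  hQ ξ

/-- **Read-back of the package at a NON-SPLIT place** — the consumer's `sFin₀ ξ v := (hQ.nonsplit ξ v hns T a ha h μZ π2 πn hK hn).πs` ((J3) of RULING (V29);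
★ `CMNonsplitCharIdentityAt.πs`, `….charIdentityAt_πs`). [cite: Rogawski1990, §13.1 Prop. 13.1.3 (d), Prop. 13.1.4 p. 199; §12.2 p. 174; §13.3 p. 202] -/
theorem CMCharIdentityPackage.nonsplit (hQ : CMCharIdentityPackage L H hH hHd νH νG μω hμu Δ mH mG) (ξ : OneDimAutRepH L)
    (v : HeightOneSpectrum (𝓞 ↥(maximalRealSubfield L))) (hns : ∀ w : PlacesOver L v, IsCMField.complexConj L • w.1 = w.1)
    (T : GL (Fin 3) (LocalRing L v)) (a : LocalRing L v) (ha : IsUnit a)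
    (h : formCongr (conjLocal L (IsCMField.complexConj L) v) T (H.map (algebraMap L (LocalRing L v))) =
      a • (Matrix.of fun i j : Fin 3 => if i.val + j.val + 1 = 3 then (1 : L) else 0).map (algebraMap L (LocalRing L v)))
    [MeasurableSpace (Gqs L v ⧸ Subgroup.center (Gqs L v))] [BorelSpace (Gqs L v ⧸ Subgroup.center (Gqs L v))]
    (μZ : Measure (Gqs L v ⧸ Subgroup.center (Gqs L v))) [μZ.IsHaarMeasure] (π2 πn : IrrClass (Gqs L v))
    (hK : KeysCaseTwoLabels L v (μω.semilocalComponent L v) (torusLocalComponent L (IsCMField.complexConj L) v ξ.η)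
      (torusLocalComponent L (IsCMField.complexConj L) v ξ.ψ) π2 πn)
    (hn : ¬ πn.IsSquareIntegrable μZ) :
    CMNonsplitCharIdentityAt L v H (Δ v) (mH v) (mG v) (νG v) (νH v) (ξ.xiLocalChar v)
      (IrrClass.comap (cmDatumLocalCongr L v T ha h).symm πn) :=
  (hQ ξ).nonsplit v hns T a ha h μZ π2 πn hK hn

/-- **Read-back of the package at a SPLIT place.** [cite: Rogawski1990, §4.13 Lemma 4.13.1 (b); §13.1 Prop. 13.1.4 p. 199; §13.3 pp. 201–202] -/
theorem CMCharIdentityPackage.split (hQ : CMCharIdentityPackage L H hH hHd νH νG μω hμu Δ mH mG) (ξ : OneDimAutRepH L)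
    (v : HeightOneSpectrum (𝓞 ↥(maximalRealSubfield L))) (hs : ∃ w : PlacesOver L v, IsCMField.complexConj L • w.1 ≠ w.1) :
    CMSplitCharIdentityAt L v H hH hHd (splitWitness v hs) (splitWitness_spec v hs) (ξ.splitν₀ μω (splitWitness v hs).1)
      (ξ.locψ (splitWitness v hs).1) (ξ.norm_splitν₀_apply hμu (splitWitness v hs).1)
      (ξ.continuous_splitν₀ μω (splitWitness v hs).1) (ξ.norm_locψ_apply (splitWitness v hs).1)
      (ξ.continuous_locψ (splitWitness v hs).1) (Δ v) (mH v) (mG v) (νG v) (νH v) (ξ.xiLocalChar v) :=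
  (hQ ξ).split v hs

end Clauses

end Literature.NumberTheory.Rogawski1990

end
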